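import Literature.ModelTheory.ExponentialFields.LastRootCertificate
import HarnessLib

/-!
# The r.e. scheme of certificate implications of the Last-Root decision procedure

Family `periods` (periods.S26/S27), topic `Literature/ModelTheory/ExponentialFields`, in support of
the named fact
`Literature.ModelTheory.ExponentialFields.macintyreWilkie_realExpDecidable_iff_lastRootConjecture`
(`LastRootConjecture.lean`: `RealExpDecidable ↔ LastRootConjecture`, Macintyre–Wilkie 1996 as
reported by Berarducci–Servi 2004, p. 44).  Third file of the direction `←` (after
`LastRootSeparation.lean`, `LastRootCertificate.lean`).

For a modulus `θ : ℕ × List ExpPolyCode × ExpPolyCode → ℕ` the **certificate implication** of a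
code triple `(n, F, P)` is the sentence

  `implSentence θ n F P := (∃ȳ Ĝ(n, F, P, θ(n, F, P))(ȳ) = 0) ⟹ (∃x̄ P(x̄) = 0)`,

`Ĝ` the certificate system of `LastRootCertificate.lean` (both sides are *zero sentences*
`ExpPolyCode.zeroSentence` of square code systems, the conclusion that of the one-row system
`[P]`).  This file proves:

* semantics of zero sentences in lawful structures (`realize_zeroSentence_iff`, `…_real_iff`,
  `realize_zeroSentence_singleton`, `exists_zero_of_realize_zeroSentence_singleton`);
* **truth** (`ExpPolyCode.real_models_implSentence`, `implScheme_subset_realExpTheory`): if `θ`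
  *separates* — `1 < θ(n, F, P) · |P(ā)|` at every zero `ā` of the rows of `F` with invertible
  Jacobian and `P(ā) ≠ 0`, which is what the Last Root Conjecture provides
  (`ExpPolyCode.exists_separation_of_lastRootConjecture`) — then every certificate implication
  is true in `ℝ_exp` (a real zero of `Ĝ` is such an `ā` with `θ |P(ā)| < 1`, `of_cert_zero_real`);
* **recursive enumerability** (`ExpPolyCode.implScheme_isREAxioms`): for computable `θ` the scheme
  `implScheme θ = {implSentence θ n F P | n, F, P}` is an r.e. set of sentences — its Gödel
  numbers are a computable function of `(n, F, P)` (letters of `exs`, `formulaLetters_exs`, on top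
  of the letter calculus of `LastRootConjectureOfDecidable.lean` / `CodeNewtonLetters.lean` and
  `primrec_certCode`), and the range of a computable function is r.e.
  (`REPred.range_of_computable`).

Everything here is proved; the definitions are syntax (sentences, letters).

## References

* A. Macintyre, A. J. Wilkie, *On the decidability of the real exponential field*, in:
  Kreiseliana, A K Peters (1996), 441–467, §§4–5 (primary source not held).
* G. O. Jones, T. Servi, *On the decidability of the real field with a generic power function*,
  J. Symb. Log. 76 (2011), §3.
* H. B. Enderton, *A Mathematical Introduction to Logic*, 2nd ed. (2001), §3.4 (arithmetization
  of syntax).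
-/

noncomputable section

namespace Literature.ModelTheory.ExponentialFields

namespace ExpPolyCode

open FirstOrder FirstOrder.Language FirstOrder.Language.Structure Encodable ProofTheory.PreFOL

/-! ### The zero sentence of a code system -/

section ZeroSentence

variable (n : ℕ) (G : List ExpPolyCode)

/-- **"the system `G` of `n` codes in `n` unknowns has a common zero"**: `∃x̄ ⋀ᵢ Gᵢ(x̄) = 0`. [folklore] -/
def zeroSentence : Language.orderedExpRing.Sentence :=
  (andL ((List.finRange n).map fun i => Term.bdEqual (rowTerm n G i) 0)).exs

/-- Semantics of the zero sentence in any lawful structure on a field: a common zero of the row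
terms. [folklore] -/
theorem realize_zeroSentence_iff (M : Type*) [Language.orderedExpRing.Structure M] [Field M] [LinearOrder M]
    [RealExpModel.LawfulStructure M] :
    M ⊨ zeroSentence n G ↔
      ∃ x : Fin n → M, ∀ i : Fin n, (rowTerm n G i).realize (Sum.elim (default : Empty → M) x) = 0 := by
  unfold zeroSentence Sentence.Realize
  rw [BoundedFormula.realize_exs]
  refine exists_congr fun x => ?_
  rw [NewtonExp.realize_andL_map_iff]
  simp

/-- In particular in `ℝ`: a common zero of the rows `x̄ ↦ Gᵢ(x̄)`. [folklore] -/
theorem realize_zeroSentence_real_iff :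
    ℝ ⊨ zeroSentence n G ↔ ∃ x : Fin n → ℝ, ∀ i : Fin n, eval n (G.getD i []) x = 0 := by
  rw [realize_zeroSentence_iff]
  simp only [realize_rowTerm]

/-- The zero sentence of the one-row system `[P]`: from a zero of `P` (the other rows are the
zero polynomial). [folklore] -/
theorem realize_zeroSentence_singleton {M : Type*} [Language.orderedExpRing.Structure M] [Field M] [LinearOrder M]
    [RealExpModel.LawfulStructure M] (P : ExpPolyCode) {x : Fin n → M}
    (hx : evalWith (NewtonExp.expM M) n P x = 0) : M ⊨ zeroSentence n [P] := by
  rw [realize_zeroSentence_iff]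
  refine ⟨x, fun i => ?_⟩
  rw [realize_rowTerm_lawful]
  rcases Nat.eq_zero_or_pos (i : ℕ) with h | h
  · rw [h]; exact hx
  · obtain ⟨k, hk⟩ := Nat.exists_eq_succ_of_ne_zero h.ne'
    have hnil : ([P] : List ExpPolyCode).getD (k + 1) [] = [] := rfl
    rw [hk, hnil]
    simp [evalWith]

/-- Conversely, with at least one unknown, the zero sentence of `[P]` gives a zero of `P`. [folklore] -/
theorem exists_zero_of_realize_zeroSentence_singleton {M : Type*} [Language.orderedExpRing.Structure M] [Field M]
    [LinearOrder M] [RealExpModel.LawfulStructure M] {m : ℕ} (P : ExpPolyCode)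
    (h : M ⊨ zeroSentence (m + 1) [P]) : ∃ x : Fin (m + 1) → M, evalWith (NewtonExp.expM M) (m + 1) P x = 0 := by
  obtain ⟨x, hx⟩ := (realize_zeroSentence_iff (m + 1) [P] M).1 h
  refine ⟨x, ?_⟩
  have := hx 0
  rwa [realize_rowTerm_lawful] at this

/-! #### Gödel letters of the zero sentence -/

/-- letters of `exs` (closing all `k` free variables existentially) [folklore] -/
theorem formulaLetters_exs : ∀ (k : ℕ) (φ : Language.orderedExpRing.BoundedFormula Empty k),
    formulaLetters φ.exs = exNL 0 k (formulaLetters φ)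
  | 0, φ => by rw [BoundedFormula.exs.eq_1, exNL.eq_1]
  | k + 1, φ => by
    rw [BoundedFormula.exs.eq_2, formulaLetters_exs k, exNL.eq_2]
    show exNL 0 k (formulaLetters φ.ex) = _
    rw [formulaLetters_ex]
    simp only [Nat.zero_add]

/-- the letters of the zero sentence [folklore] -/
def zeroSL : List ℕ :=
  exNL 0 n (andLL n ((List.range n).map fun i => eqL n (FqL n G i) [lZero]))

/-- **The letters of the zero sentence.** [folklore] -/
theorem formulaLetters_zeroSentence : formulaLetters (zeroSentence n G) = zeroSL n G := by
  rw [zeroSentence, formulaLetters_exs, formulaLetters_andL, List.map_map, zeroSL,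
    ← List.map_coe_finRange_eq_range, List.map_map]
  congr 2
  refine List.map_congr_left fun i _ => ?_
  simp only [Function.comp_apply, formulaLetters_bdEqual, termLetters_zero', FqL, rowTerm]
  rw [termLetters_evalTermX n (fun j => var (Sum.inr j)) xvL (fun j => by rw [termLetters_var]; rfl)]

/-- **The Gödel number of the zero sentence.** [folklore] -/
theorem godelNumber_zeroSentence : (zeroSentence n G).godelNumber = encode (zeroSL n G) := by
  rw [godelNumber_eq, formulaLetters_zeroSentence]

/-- The letters of the zero sentence are primitive recursive in `(n, G)`. [folklore] -/
theorem primrec_zeroSL : Primrec fun p : ℕ × List ExpPolyCode => zeroSL p.1 p.2 := by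
  unfold zeroSL
  refine primrec_exNL.comp (Primrec.pair (Primrec.const 0) (Primrec.pair Primrec.fst ?_))
  refine primrec_andLL.comp Primrec.fst (Primrec.list_map (Primrec.list_range.comp Primrec.fst) ?_)
  exact (primrec_eqL.comp (Primrec.pair (Primrec.fst.comp Primrec.fst) (Primrec.pair
    (primrec_FqL.comp (Primrec.pair Primrec.fst Primrec.snd)) (Primrec.const [lZero])))).to₂

/-- The Gödel number of the zero sentence is computable in `(n, G)`. [folklore] -/
theorem computable_godelNumber_zeroSentence :
    Computable fun p : ℕ × List ExpPolyCode => (zeroSentence p.1 p.2).godelNumber := by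
  have : (fun p : ℕ × List ExpPolyCode => (zeroSentence p.1 p.2).godelNumber) =
      fun p => encode (zeroSL p.1 p.2) := funext fun p => godelNumber_zeroSentence p.1 p.2
  rw [this]
  exact (Primrec.encode.comp primrec_zeroSL).to_comp

end ZeroSentence

/-! ### The scheme of certificate implications -/

section Scheme

variable (θ : ℕ × List ExpPolyCode × ExpPolyCode → ℕ) (n : ℕ) (F : List ExpPolyCode) (P : ExpPolyCode)

/-- **The certificate implication** of `(n, F, P)` for a modulus `θ`: "if the certificate system
`Ĝ(n, F, P, θ(n, F, P))` has a zero, then `P` has a zero" —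
`(∃ȳ Ĝ(ȳ) = 0) ⟹ (∃x̄ P(x̄) = 0)`. [folklore] -/
def implSentence : Language.orderedExpRing.Sentence :=
  zeroSentence (n + (n * n + 3)) (certCode n F P (θ (n, F, P))) ⟹ zeroSentence n [P]

/-- **The scheme of certificate implications** (all `(n, F, P)`). [folklore] -/
def implScheme : Language.orderedExpRing.Theory :=
  {σ | ∃ (n : ℕ) (F : List ExpPolyCode) (P : ExpPolyCode), σ = implSentence θ n F P}

/-- Membership in the scheme. [folklore] -/
theorem implSentence_mem_implScheme : implSentence θ n F P ∈ implScheme θ := ⟨n, F, P, rfl⟩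

variable {θ}

/-- **Truth of the certificate implications in `ℝ_exp` under a separating modulus**: if
`1 < θ(n, F, P) · |P(ā)|` whenever `ā` is a zero of the rows of `F` with invertible Jacobian
and `P(ā) ≠ 0` (which the Last Root Conjecture provides,
`exists_separation_of_lastRootConjecture`), then every certificate implication is true in `ℝ`:
a real zero of `Ĝ` yields such an `ā` with `θ |P(ā)| < 1`, whence `P(ā) = 0`. [folklore] -/
theorem real_models_implSentence
    (hθ : ∀ (n : ℕ) (F : List ExpPolyCode) (P : ExpPolyCode) (a : Fin n → ℝ),
      (∀ i : Fin n, eval n (F.getD i []) a = 0) → (jac n F a).det ≠ 0 → eval n P a ≠ 0 →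
        1 < θ (n, F, P) * |eval n P a|) :
    ℝ ⊨ implSentence θ n F P := by
  unfold implSentence
  rw [Sentence.realize_imp, realize_zeroSentence_real_iff]
  rintro ⟨y, hy⟩
  obtain ⟨hF, hJ, hsmall⟩ := of_cert_zero_real n F P (θ (n, F, P)) hy
  have hP : eval n P (xOf n y) = 0 := by
    by_contra hP
    have := hθ n F P (xOf n y) hF hJ hP
    linarith
  refine realize_zeroSentence_singleton n P (x := xOf n y) ?_
  rw [← hP, ← evalWith_real]
  rfl

/-- Hence the scheme is a set of sentences true in `ℝ_exp`. [folklore] -/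
theorem implScheme_subset_realExpTheory
    (hθ : ∀ (n : ℕ) (F : List ExpPolyCode) (P : ExpPolyCode) (a : Fin n → ℝ),
      (∀ i : Fin n, eval n (F.getD i []) a = 0) → (jac n F a).det ≠ 0 → eval n P a ≠ 0 →
        1 < θ (n, F, P) * |eval n P a|) :
    implScheme θ ⊆ realExpTheory := by
  rintro σ ⟨n, F, P, rfl⟩
  exact Language.mem_completeTheory.2 (real_models_implSentence n F P hθ)

/-- the letters of a certificate implication, as a function of `(n, F, P, η)` [folklore] -/
def implSL (n : ℕ) (F : List ExpPolyCode) (P : ExpPolyCode) (η : ℕ) : List ℕ :=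
  impL (zeroSL (n + (n * n + 3)) (certCode n F P η)) (zeroSL n [P])

/-- The Gödel number of a certificate implication. [folklore] -/
theorem godelNumber_implSentence :
    (implSentence θ n F P).godelNumber = encode (implSL n F P (θ (n, F, P))) := by
  rw [godelNumber_eq, implSentence, implSL]
  show encode (formulaLetters (BoundedFormula.imp _ _)) = _
  rw [formulaLetters_imp, formulaLetters_zeroSentence, formulaLetters_zeroSentence]
  rfl

/-- `implSL` is primitive recursive in `(n, F, P, η)`. [folklore] -/
theorem primrec_implSL :
    Primrec fun q : ℕ × List ExpPolyCode × ExpPolyCode × ℕ => implSL q.1 q.2.1 q.2.2.1 q.2.2.2 := by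
  unfold implSL
  have hn : Primrec fun q : ℕ × List ExpPolyCode × ExpPolyCode × ℕ => q.1 := Primrec.fst
  have hP : Primrec fun q : ℕ × List ExpPolyCode × ExpPolyCode × ℕ => q.2.2.1 := Primrec.fst.comp (Primrec.snd.comp Primrec.snd)
  refine primrec_impL.comp (primrec_zeroSL.comp (Primrec.pair (primrec_certDim.comp hn) primrec_certCode))
    (primrec_zeroSL.comp (Primrec.pair hn (Primrec.list_cons.comp hP (Primrec.const []))))

/-- **The Gödel number of a certificate implication is computable in `(n, F, P)`** for a
computable modulus. [folklore] -/
theorem computable_godelNumber_implSentence (hθ : Computable θ) :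
    Computable fun p : ℕ × List ExpPolyCode × ExpPolyCode => (implSentence θ p.1 p.2.1 p.2.2).godelNumber := by
  have hg : Computable fun p : ℕ × List ExpPolyCode × ExpPolyCode => (p.1, p.2.1, p.2.2, θ (p.1, p.2.1, p.2.2)) :=
    Computable.pair Computable.fst (Computable.pair (Computable.fst.comp Computable.snd)
      (Computable.pair (Computable.snd.comp Computable.snd) hθ))
  exact (((Primrec.encode.comp primrec_implSL).to_comp).comp hg).of_eq fun p =>
    (godelNumber_implSentence p.1 p.2.1 p.2.2).symm

/-- **The scheme of certificate implications is an r.e. set of sentences** (the range of a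
computable function). [folklore] -/
theorem implScheme_isREAxioms (hθ : Computable θ) : (implScheme θ).IsREAxioms := by
  refine (REPred.range_of_computable (computable_godelNumber_implSentence hθ)).of_eq fun k => ⟨?_, ?_⟩
  · rintro ⟨p, hp⟩
    exact ⟨_, implSentence_mem_implScheme θ p.1 p.2.1 p.2.2, hp⟩
  · rintro ⟨φ, ⟨n, F, P, rfl⟩, hk⟩
    exact ⟨(n, F, P), hk⟩

end Scheme

end ExpPolyCode

end Literature.ModelTheory.ExponentialFields

end
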